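import Literature.AlgebraicGeometry.Frobenioids.BaseSectionsOfObjects
import Literature.AnabelianGeometry.EtaleTheta.BiKummerOfModelCanonical
import Literature.AnabelianGeometry.EtaleTheta.Discharge.Sec4Model
import Literature.AnabelianGeometry.EtaleTheta.Discharge.Sec4Prop42iv

/-!
# [EtTh] Prop 4.2 (iv) for the canonical model instance of the §4 setting
# (`BiKummerSetting.mkOfModelCanonical`): the dictionary and naturality inputs discharged

Mochizuki, *The étale theta function …*, Publ. RIMS **45** (2009), §4, Prop. 4.2 (iv), PDF pp. 88–90
[cite: MochizukiEtTh2009, Prop 4.2(iv) p.89].  abc-iut cell, layer L2, node `EtTh:Prop4.2(iv)` (seat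
abc-iut-w5-d063), sequel to `Discharge/Sec4Prop42iv.lean` (`BiKummerSetting.prop42_iv_of`).

For abc-iut-L2-t9's canonical instantiation `BiKummerSetting.mkOfModelCanonical` of the §4 setting
(`O^×(A^birat) := B(A_D)^×`, `s' · (s'')⁻¹ := u_{s'} · u_{s''}⁻¹`, "arise from a base-Frobenius pair" :=
`TemperedFrobenioid.ArisesFromBaseFrobeniusPair`, [FrdI] Def. 2.7 over abc-iut-L1-t2's
`IsBaseFrobeniusPair`) and the transport `pullFrac := pullFracModel` (`B(Base α')` on units):
* the dictionary hypotheses `toB`, `hfrac`, `hpull` of `prop42_iv_of` hold with `toB = id` (as in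
  abc-iut-L6-t12's `Discharge/Sec4Model.lean`);
* the NATURALITY input `hnat` is a theorem: a base-Frobenius pair `(P, F)` has `F(n) ∈ End(P ↪ C)`, a
  natural endomorphism of the inclusion functor ([FrdI] Def. 2.7 (ii)), so for `G, α', α''` arising from
  `(P, F)` ([EtTh] Def. 4.1 (iv)(e)) the component `F(n)_B` at the codomain satisfies
  `α' ∘ α''_A = F(n)_B ∘ α'` (`TemperedFrobenioid.ArisesFromBaseFrobeniusPair.exists_natural`).
* the input `hP56` (conjugacy of the degree-`n` Frobenius lifts at `A_⊙`) follows from the tree's NAMED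
  statements of [FrdI] Prop. 5.6 (`Frobenioids.PreFrobenioid.Prop56`, FACT-LIST F-0946, with
  `Prop56_exists`, F-0947) under their printed antecedents ("`C` of model and unit-profinite type" —
  [EtTh] Thm. 3.7 (i); isotropic type is a theorem for the model, `ModelFrobenioid.isIsotropic`,
  and pre-model type is witnessed by the base-Frobenius pair itself)
  (`TemperedFrobenioid.ArisesFromBaseFrobeniusPair.exists_units_conj_of_prop56`).
Hence Prop. 4.2 (iv) holds for the canonical model given `Φ` divisorial and the two remaining printed
inputs BY NAME: [FrdI] Prop. 5.6 at `A_⊙` (`hP56`, or the named `Prop56`/`Prop56_exists` with the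
Thm. 3.7 (i) antecedents — `prop42_iv_mkOfModelCanonical_of_prop56`) and the `N`-th roots of pulled-back
units supplied by `(N, H_⊙, f|_{A_N})`-saturation ([EtTh] p.316, `hsat`).
HONEST FRAMING: nothing here asserts that such data exist for an actual curve; no side is taken on any
disputed claim.
-/

noncomputable section

namespace Literature.AnabelianGeometry.EtaleTheta

open CategoryTheory Opposite Literature.AlgebraicGeometry.Frobenioids

universe u₀ v₀ u v w

namespace TemperedFrobenioid

variable {D₀ : Type u₀} [Category.{v₀} D₀] {V : FrdIMonoidStub.{w}}
  {T : RealifiedDivisorMonoids (D₀ := D₀) V} {D : Type u} [Category.{v} D]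
  {VD : FrdICatStub.{u, v, w} D} (C : TemperedFrobenioid T D VD)

/-- **Naturality of the Frobenius section along a `P`-distinguished arrow** ([FrdI] Def. 2.7 (ii):
`F(n) ∈ End(P ↪ C)` is an endomorphism of the inclusion FUNCTOR, whose components are base-identity
endomorphisms of Frobenius degree `n`): if `G, α', α''` arise from a base-Frobenius pair `(P, F)`
([EtTh] Def. 4.1 (iv)(e), `ArisesFromBaseFrobeniusPair`), with `α'' = F(n)_A`, then the component
`φ_B := F(n)_B` at the codomain `B` of `α'` is `F`-distinguished (for the same pair; `B ∈ Ob(P)`), is a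
base-identity endomorphism of the same Frobenius degree, and `α' ∘ α'' = φ_B ∘ α'`.  This is the input
`hnat` of `BiKummerSetting.prop42_iv_of`. [cite: MochizukiFrdI2008, Def. 2.7(ii) p.51] -/
theorem ArisesFromBaseFrobeniusPair.exists_natural {A B : C.category} {G : Subgroup (Aut A)}
    {α₂ : A ⟶ A} {α₁ : A ⟶ B} (h : C.ArisesFromBaseFrobeniusPair G α₂ α₁) :
    ∃ φ : B ⟶ B, C.ArisesFromBaseFrobeniusPair ⊥ φ (𝟙 B) ∧ PreFrobenioid.IsBaseIdentity C.toElem φ ∧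
      PreFrobenioid.degFr C.toElem φ = PreFrobenioid.degFr C.toElem α₂ ∧ α₂ ≫ α₁ = α₁ ≫ φ := by
  obtain ⟨P, Fr, hPF, -, h₁, hA, n, hn⟩ := h
  subst hn
  have hB : P.obj B := (P.obj_of_hom α₁ h₁).2
  refine ⟨(Fr n).app ⟨B, hB⟩, ⟨P, Fr, hPF, ?_, P.hom_id hB, hB, n, rfl⟩,
    hPF.isFrobeniusSection.isBaseIdentity n ⟨B, hB⟩,
    (hPF.isFrobeniusSection.degFr_eq n ⟨B, hB⟩).trans (hPF.isFrobeniusSection.degFr_eq n ⟨A, hA⟩).symm,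
    ((Fr n).naturality (X := ⟨A, hA⟩) (Y := ⟨B, hB⟩) ⟨α₁, h₁⟩).symm⟩
  intro γ hγ
  rw [Subgroup.mem_bot] at hγ
  rw [hγ]
  exact P.hom_id hB

/-- **The input `hP56` of `BiKummerSetting.prop42_iv_of` from the NAMED [FrdI] Prop. 5.6**: for a tempered
Frobenioid `C` satisfying the antecedents of [FrdI] Prop. 5.6 as printed ("`C` is of model [hence, in
particular, isotropic] and unit-profinite type" — [EtTh] Thm. 3.7 (i); here: `C → F_Φ` a Frobenioid, of
birationally Frobenius-normalized, Frobenius-normalized and unit-profinite type, over a birationalization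
datum `Bd`; isotropic type is [FrdI] Thm. 5.2 (ii) for the model, and pre-model type is witnessed by the
base-Frobenius pair at hand), the tree's named statements `PreFrobenioid.Prop56` (FACT-LIST F-0946) and
`PreFrobenioid.Prop56_exists` (F-0947) give: two `F`-distinguished endomorphisms of a Frobenius-trivial
`A` of the same Frobenius degree, coming from two base-Frobenius pairs of `C`, are conjugate by an element
of `O^×(A)` ("up to conjugation [as a pair!] by an element of `O^×(A)`", [FrdI] p.105).
[cite: MochizukiFrdI2008, Prop. 5.6 p.105] -/
theorem ArisesFromBaseFrobeniusPair.exists_units_conj_of_prop56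
    {Bd : (PreFrobenioidData.ofFunctor C.divisorMonoid C.toElem).BiratData}
    (h56 : PreFrobenioid.Prop56 C.toElem Bd) (h56e : PreFrobenioid.Prop56_exists C.toElem)
    (hF : PreFrobenioid.IsFrobenioid C.toElem)
    (hbfn : PreFrobenioidData.IsOfBiratFrobeniusNormalizedType Bd)
    (hfn : PreFrobenioid.IsOfType (PreFrobenioid.IsFrobeniusNormalized C.toElem))
    (hup : PreFrobenioid.IsOfUnitProfiniteType C.toElem)
    {A : C.category} (hA : PreFrobenioid.IsFrobeniusTrivial C.toElem A) {φ φ' : A ⟶ A}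
    (hφ : C.ArisesFromBaseFrobeniusPair ⊥ φ (𝟙 A)) (hφ' : C.ArisesFromBaseFrobeniusPair ⊥ φ' (𝟙 A))
    (hdeg : PreFrobenioid.degFr C.toElem φ = PreFrobenioid.degFr C.toElem φ') :
    ∃ ε : Aut A, ε ∈ C.units A ∧ φ' = ε.inv ≫ φ ≫ ε.hom := by
  have hiso : PreFrobenioid.IsOfIsotropicType C.toElem :=
    fun Y => ModelFrobenioid.isIsotropic (C.isGroupLike_ratFnFunctor T.isUnit_BΛ) Y
  have hpm : PreFrobenioid.IsOfPreModelType C.toElem := hφ.isOfPreModelType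
  obtain ⟨P, Fr, hPF, -, -, hA₁, n, hn⟩ := hφ
  obtain ⟨P', Fr', hPF', -, -, hA₁', n', hn'⟩ := hφ'
  subst hn
  subst hn'
  have hnn : n = n' := (hPF.isFrobeniusSection.degFr_eq n ⟨A, hA₁⟩).symm.trans
    (hdeg.trans (hPF'.isFrobeniusSection.degFr_eq n' ⟨A, hA₁'⟩))
  subst hnn
  obtain ⟨σ, ψ, hr⟩ := h56e hF P Fr hPF A hA₁
  obtain ⟨σ', ψ', hr'⟩ := h56e hF P' Fr' hPF' A hA₁'
  obtain ⟨u, hu, hconj⟩ := h56 hF hpm hbfn hfn hiso hup P Fr P' Fr' hPF hPF' A hA σ σ' ψ ψ' hr hr'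
  refine ⟨u, hu, ?_⟩
  have e1 : ((Fr' n).app ⟨A, hA₁'⟩ : A ⟶ A) = ψ' n := (hr'.φ_eq n).symm
  have e2 : (ψ' n : A ⟶ A) = u.inv ≫ ψ n ≫ u.hom := hconj.2 n
  have e3 : (u.inv ≫ ψ n ≫ u.hom : A ⟶ A) = u.inv ≫ (Fr n).app ⟨A, hA₁⟩ ≫ u.hom :=
    congrArg (fun x : End A => u.inv ≫ x ≫ u.hom) (hr.φ_eq n)
  exact e1.trans (e2.trans e3)

end TemperedFrobenioid

namespace BiKummerSetting

variable {K : Type u₀} [Field K] (X : SemiGraphs.TemperedArithmeticGroup.{u₀} K) {D₀ : Type u₀}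
  [Category.{v₀} D₀] {V : FrdIMonoidStub.{w}} {T : RealifiedDivisorMonoids (D₀ := D₀) V}
  {D : Type u} [Category.{v} D] {VD : FrdICatStub.{u, v, w} D}
  (tf : TemperedFrobenioid T D VD) (hZ : tf.monoidType = MonoidType.Z)
  (hP : ∀ A : Dᵒᵖ, IsPerfect (tf.Φ.carrier A)) (IG : D → Prop) (gS : ∀ A : D, IG A → (X.Pi →* Aut A))
  (gSs : ∀ (A : D) (h : IG A), Function.Surjective (gS A h))
  (NH : Subgroup (Field.absoluteGaloisGroup K) → tf.category → ℕ+ → Prop) (A₀ : tf.category)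
  (hA₀ : PreFrobenioid.IsFrobeniusTrivial tf.toElem A₀) (hA₀' : IG A₀.base)

/-- **[EtTh] Prop. 4.2 (iv) for the canonical model instance** `mkOfModelCanonical` of the §4 setting,
with `pullFrac := pullFracModel` (`((α')^birat)^* = B(Base α')` on `O^×(−^birat) = B(−)^×`): the
dictionary inputs (`toB = id`) and the naturality input `hnat` of `prop42_iv_of` are theorems, so the
statement holds given `Φ` divisorial ([FrdI] Thm. 5.2 (ii)) and the two remaining printed inputs BY
NAME — [FrdI] Prop. 5.6 at the Frobenius-trivial `A_⊙` (`hP56`: degree-`n` `F`-distinguished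
endomorphisms of `A_⊙` from two base-Frobenius pairs are `O^×(A_⊙)`-conjugate) and the sentence of the
printed proof (p.316) on `N`-th roots of pulled-back units under `(N, H_⊙, g)`-saturation (`hsat`).
[cite: MochizukiEtTh2009, Prop 4.2(iv) p.89] -/
theorem prop42_iv_mkOfModelCanonical
    (hΦd : Objectwise (fun M _ => IsDivisorial M) tf.divisorMonoid)
    (hP56 : ∀ {φ φ' : A₀ ⟶ A₀}, tf.ArisesFromBaseFrobeniusPair ⊥ φ (𝟙 A₀) →
      tf.ArisesFromBaseFrobeniusPair ⊥ φ' (𝟙 A₀) →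
        PreFrobenioid.degFr tf.toElem φ = PreFrobenioid.degFr tf.toElem φ' →
          ∃ ε : Aut A₀, ε ∈ tf.units A₀ ∧ φ' = ε.inv ≫ φ ≫ ε.hom)
    (hsat : ∀ {A : tf.category} {N : ℕ+} {g : tf.biratUnitsModel A},
      (mkOfModelCanonical X tf hZ hP IG gS gSs NH A₀ hA₀ hA₀').IsSaturated A N g →
        ∀ {α : A ⟶ A₀}
          (d : (mkOfModelCanonical X tf hZ hP IG gS gSs NH A₀ hA₀ hA₀').BaseFrobeniusTypeData α),
          PreFrobenioid.degFr tf.toElem α = N → ∀ ε : Aut A₀, ε ∈ tf.units A₀ →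
            ∃ r : Aut A, r ∈ tf.units A ∧
              ModelFrobenioid.unit r.hom ^ (N : ℕ) =
                pull tf.ratFnFunctor (ModelFrobenioid.baseMap d.α₁) (ModelFrobenioid.unit ε.hom)) :
    (mkOfModelCanonical X tf hZ hP IG gS gSs NH A₀ hA₀ hA₀').Prop42_iv
      (fun {_ _} φ x => tf.pullFracModel φ x) := by
  refine prop42_iv_of (S := mkOfModelCanonical X tf hZ hP IG gS gSs NH A₀ hA₀ hA₀')
    (pullFrac := fun {_ _} φ x => tf.pullFracModel φ x) hΦd (tf.isGroupLike_ratFnFunctor T.isUnit_BΛ)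
    (fun A => MonoidHom.id (tf.biratUnitsModel A)) ?_ ?_ ?_ hP56 hsat
  · intro A B s' s'' h' h'' hb
    exact coe_fracOfModel_mul_unit tf T.isUnit_BΛ s' s''
  · intro A A' φ x
    rfl
  · intro A B G α₂ α₁ h
    exact TemperedFrobenioid.ArisesFromBaseFrobeniusPair.exists_natural tf h

/-- **[EtTh] Prop. 4.2 (iv) for the canonical model instance, the [FrdI] Prop. 5.6 input consumed BY NAME**:
as `prop42_iv_mkOfModelCanonical`, with `hP56` replaced by the tree's named statements
`PreFrobenioid.Prop56` (FACT-LIST F-0946) and `PreFrobenioid.Prop56_exists` (F-0947) together with their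
printed antecedents on `C` ([EtTh] Thm. 3.7 (i): `C → F_Φ` a Frobenioid of birationally
Frobenius-normalized, Frobenius-normalized and unit-profinite type); the only other residual input is the
`N`-th-root sentence of the printed proof (`hsat`, p.316). [cite: MochizukiEtTh2009, Prop 4.2(iv) p.89] -/
theorem prop42_iv_mkOfModelCanonical_of_prop56
    (hΦd : Objectwise (fun M _ => IsDivisorial M) tf.divisorMonoid)
    {Bd : (PreFrobenioidData.ofFunctor tf.divisorMonoid tf.toElem).BiratData}
    (h56 : PreFrobenioid.Prop56 tf.toElem Bd) (h56e : PreFrobenioid.Prop56_exists tf.toElem)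
    (hF : PreFrobenioid.IsFrobenioid tf.toElem)
    (hbfn : PreFrobenioidData.IsOfBiratFrobeniusNormalizedType Bd)
    (hfn : PreFrobenioid.IsOfType (PreFrobenioid.IsFrobeniusNormalized tf.toElem))
    (hup : PreFrobenioid.IsOfUnitProfiniteType tf.toElem)
    (hsat : ∀ {A : tf.category} {N : ℕ+} {g : tf.biratUnitsModel A},
      (mkOfModelCanonical X tf hZ hP IG gS gSs NH A₀ hA₀ hA₀').IsSaturated A N g →
        ∀ {α : A ⟶ A₀}
          (d : (mkOfModelCanonical X tf hZ hP IG gS gSs NH A₀ hA₀ hA₀').BaseFrobeniusTypeData α),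
          PreFrobenioid.degFr tf.toElem α = N → ∀ ε : Aut A₀, ε ∈ tf.units A₀ →
            ∃ r : Aut A, r ∈ tf.units A ∧
              ModelFrobenioid.unit r.hom ^ (N : ℕ) =
                pull tf.ratFnFunctor (ModelFrobenioid.baseMap d.α₁) (ModelFrobenioid.unit ε.hom)) :
    (mkOfModelCanonical X tf hZ hP IG gS gSs NH A₀ hA₀ hA₀').Prop42_iv
      (fun {_ _} φ x => tf.pullFracModel φ x) :=
  prop42_iv_mkOfModelCanonical X tf hZ hP IG gS gSs NH A₀ hA₀ hA₀' hΦd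
    (fun hφ hφ' hdeg =>
      TemperedFrobenioid.ArisesFromBaseFrobeniusPair.exists_units_conj_of_prop56 tf h56 h56e hF hbfn hfn
        hup hA₀ hφ hφ' hdeg)
    hsat

end BiKummerSetting

end Literature.AnabelianGeometry.EtaleTheta

end
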